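import Summits.Ventures.GridStability.Bench.CHIANG3Deg4ARecertDDeg4A8eqbLowhData1
import Summits.Ventures.GridStability.Lyapunov.PolyRecastBox
import Mathlib.Tactic.Linarith
import Mathlib.Tactic.Positivity
import HarnessLib

/-!
# G1.a′+ «CHIANG3 deg-4» — REGION-SIZE rider «CHIANG3-DEG4 BALL» (recast half): the gauge ball
# `Σ(σ_k² + κ_k²) + Σω_k² ≤ (397/500)²` on `{h = 0}` lies in the certified sublevel piece `{V₄ ≤ 49199/50000}`

Venture GRIDFUSION, cell `gridfusion`; seat gridfusion-lyap-2 (g4), LOW rider (pattern of «#50′ BALL» p537844 / «#62′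
WSCC9-DEG4-BALL» p543377): a kernel INNER description of the certified set of the deg-4 toolchain-A certificate of rung G1.a′
«CHIANG3» («+» row; `Bench/CHIANG3Deg4ARecertDDeg4A8eqbLowh{Data1–8,Psd1,Chk1,Part1–2,}.lean`, sos-5; A file
`cert/A/CHIANG3-deg4-A-recertD-deg4-A8eqb-lowh.json` sha256 `6a92736e6fd72f0c…`, sos-1 kit j262411; -roa companion
`Bench/CHIANG3Deg4ARecertDDeg4A8eqbLowhRoa(+Model).lean`, lyap-2 g4), so that the 3-machine ROA sentence of the deg-4 row names a
concrete neighbourhood of the stable equilibrium point. Inputs: the degree-4 literal `…_V_poly` (150 monomials) and the recast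
constraint(s) `…_h` of the Data file; the generic box majorant `Lyapunov/PolyRecastBox.lean` (p536818). NOTHING of the certificate
is restated; generator `gen_ball.py chiang4` (HOME/lean/lyap-2/g4/; `s` found by exact search on the 1/1000 grid, V_poly parsed from
the TREE file).

WHAT IS PROVED (kernel). With `s = 397/500`: on `{h = 0}` (`h_j = κ_j² + σ_j² − 2κ_j`) the ellipsoid `sigma_1² + kappa_1² + sigma_2²
+ kappa_2² + omega_1² + omega_2² ≤ s²` forces `|σ| ≤ s`, `0 ≤ κ ≤ s²/2`, `|ω| ≤ s`, and the coefficient majorant of the quartic `V`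
on that box is `absBox B V_poly = 614275866832510704301380564169/625000000000000000000000000000 ≈ 0.982841 ≤ 49199/50000` (ONE
`decide`); hence `V ≤ 49199/50000 = c` — THE ELLIPSOID LIES IN THE CERTIFIED PIECE (`…_V_le_level_of_ball`). `s` is the largest
multiple of `1/1000` passing the test (at `s + 1/1000` the majorant is ≈ 0.987609 > c). The ball is the certificate's own gauge ball
`φ = Σ z² ≤ s²` (all weights 1); other aspect ratios give (exact scan in the generator, ω²-coefficient → one-angle reach / |ω_k|
reach) 4 → 54.4°/0.474 (s = 949/1000), 1/4 → 32.3°/1.128 (s = 141/250), 1/16 → 19.2°/1.34 (s = 67/200). In the model's coordinates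
(`σ² + κ² = 2 − 2cos u ≤ u²`): every machine state of the MODEL with `u₁² + u₂² + ω₁² + ω₂² ≤ (397/500)²` (`u_k` = rotor-angle
deviation of machine `k` from the equilibrium, `ω_k` = its speed deviation, bus speed deviation `0`: ONE angle displaced by ≤ 0.794
rad = 45.5°, or both by ≤ 32.2°, or one speed deviation ≤ 0.794 in the model's dimensionless units) starts inside the certified
region (model half: sibling `…RoaBallModel.lean`); the degree / rad·s⁻¹ / percent renderings of `s` are VALIDATED-column readings of
the exact literal, nothing more.

THREE COLUMNS. CERTIFIED (kernel): the inclusion «ellipsoid of gauge radius `397/500` ∩ {h = 0} ⊆ {V ≤ 49199/50000}» for the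
certificate's `V` — a crude (coefficient-majorant) but exact inner estimate; the true inner radius is larger; an inner set of a
CERTIFICATE's sublevel piece, never «the ROA of the system». MODELLED: as the parent row (M′ = Chiang–Chu–Cauley 3-machine test
system as typed by model-1 (`Models/Chiang3.lean`: machine 3 = reference / infinite bus, network-reduced classical model with
LOSSLESS couplings — transfer conductances `G = 0`, susceptances `B = (1, 1/2, 1/2)`, unit voltages — damping `D = (2/5, 1/2)`,
dimensionless `M = 1`; the word «lossy» in the Bench certificate file's header is a template slip, the typed data decide `G = 0`),
in model-1's recast coordinates, instance CHIANG3 eq=b at the exact SEP per model-4 `bench/data/CHIANG3/equilibrium-A8.json`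
643628c23212fc7c; MODEL-VALIDITY per model-2's CHIANG3 row). VALIDATED: only the renderings of `s`. No sentence here says a machine
or a grid is stable.
-/

namespace Summit.Ventures.GridStability.Bench.CHIANG3

open Literature.Computation.Certificates Literature.Computation.Certificates.SOS
open Literature.Computation.Certificates.SOS.Poly
open Summit.Ventures.GridStability.Lyapunov

noncomputable section

/-- The box of the rider: `|σ| ≤ s`, `|κ| ≤ s²/2`, `|ω| ≤ s` with `s = 397/500`, in the certificate's variable order
`(sigma_1, kappa_1, sigma_2, kappa_2, omega_1, omega_2)`. [folklore] -/
def deg4_A_recertD_deg4_A8eqb_lowh_boxB : List ℚ := [397/500, 157609/500000, 397/500, 157609/500000, 397/500, 397/500]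

set_option maxRecDepth 100000 in
/-- **The coefficient majorant of the quartic `V` on the box is below the level**: `absBox B V_poly ≤ 49199/50000`
(ONE `decide` over the 150 monomials; exact value `614275866832510704301380564169/625000000000000000000000000000`). [folklore] -/
theorem deg4_A_recertD_deg4_A8eqb_lowh_absBox_le :
    PolyRecast.absBox (vars deg4_A_recertD_deg4_A8eqb_lowh_boxB) deg4_A_recertD_deg4_A8eqb_lowh_V_poly ≤ 49199 / 50000 := by
  decide +kernel

/-- **«BALL» (recast coordinates): the ellipsoid lies in the certified piece.** For every point of `{h = 0}` with
`sigma_1² + kappa_1² + sigma_2² + kappa_2² + omega_1² + omega_2² ≤ (397/500)²`: `V ≤ 49199/50000`. [folklore] -/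
theorem deg4_A_recertD_deg4_A8eqb_lowh_V_le_level_of_ball (sigma_1 kappa_1 sigma_2 kappa_2 omega_1 omega_2 : ℝ)
    (hh1 : deg4_A_recertD_deg4_A8eqb_lowh_h1 sigma_1 kappa_1 sigma_2 kappa_2 omega_1 omega_2 = 0) (hh2 : deg4_A_recertD_deg4_A8eqb_lowh_h2 sigma_1 kappa_1 sigma_2 kappa_2 omega_1 omega_2 = 0)
    (hball : sigma_1 ^ 2 + kappa_1 ^ 2 + sigma_2 ^ 2 + kappa_2 ^ 2 + omega_1 ^ 2 + omega_2 ^ 2 ≤ (397 / 500 : ℝ) ^ 2) :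
    deg4_A_recertD_deg4_A8eqb_lowh_V sigma_1 kappa_1 sigma_2 kappa_2 omega_1 omega_2 ≤ 49199 / 50000 := by
  simp only [deg4_A_recertD_deg4_A8eqb_lowh_h1, deg4_A_recertD_deg4_A8eqb_lowh_h1_poly, eval_cons, eval_nil, Monomial.eval_eq, Monomial.evalFrom_cons, Monomial.evalFrom_nil,
    vars_cons_zero, vars_cons_succ] at hh1
  push_cast at hh1
  simp only [deg4_A_recertD_deg4_A8eqb_lowh_h2, deg4_A_recertD_deg4_A8eqb_lowh_h2_poly, eval_cons, eval_nil, Monomial.eval_eq, Monomial.evalFrom_cons, Monomial.evalFrom_nil,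
    vars_cons_zero, vars_cons_succ] at hh2
  push_cast at hh2
  norm_num at hh1 hh2
  have hb0 : |sigma_1| ≤ (397 / 500 : ℝ) := abs_le.2 (abs_le_of_sq_le_sq' (by nlinarith [sq_nonneg sigma_1, sq_nonneg kappa_1, sq_nonneg sigma_2, sq_nonneg kappa_2, sq_nonneg omega_1, sq_nonneg omega_2]) (by norm_num))
  have hb1 : |kappa_1| ≤ (157609 / 500000 : ℝ) := abs_le.2 ⟨by nlinarith [hh1, sq_nonneg sigma_1, sq_nonneg kappa_1, sq_nonneg sigma_2, sq_nonneg kappa_2, sq_nonneg omega_1, sq_nonneg omega_2], by nlinarith [hh1, hball, sq_nonneg sigma_1, sq_nonneg kappa_1, sq_nonneg sigma_2, sq_nonneg kappa_2, sq_nonneg omega_1, sq_nonneg omega_2]⟩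
  have hb2 : |sigma_2| ≤ (397 / 500 : ℝ) := abs_le.2 (abs_le_of_sq_le_sq' (by nlinarith [sq_nonneg sigma_1, sq_nonneg kappa_1, sq_nonneg sigma_2, sq_nonneg kappa_2, sq_nonneg omega_1, sq_nonneg omega_2]) (by norm_num))
  have hb3 : |kappa_2| ≤ (157609 / 500000 : ℝ) := abs_le.2 ⟨by nlinarith [hh2, sq_nonneg sigma_1, sq_nonneg kappa_1, sq_nonneg sigma_2, sq_nonneg kappa_2, sq_nonneg omega_1, sq_nonneg omega_2], by nlinarith [hh2, hball, sq_nonneg sigma_1, sq_nonneg kappa_1, sq_nonneg sigma_2, sq_nonneg kappa_2, sq_nonneg omega_1, sq_nonneg omega_2]⟩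
  have hb4 : |omega_1| ≤ (397 / 500 : ℝ) := abs_le.2 (abs_le_of_sq_le_sq' (by nlinarith [sq_nonneg sigma_1, sq_nonneg kappa_1, sq_nonneg sigma_2, sq_nonneg kappa_2, sq_nonneg omega_1, sq_nonneg omega_2]) (by norm_num))
  have hb5 : |omega_2| ≤ (397 / 500 : ℝ) := abs_le.2 (abs_le_of_sq_le_sq' (by nlinarith [sq_nonneg sigma_1, sq_nonneg kappa_1, sq_nonneg sigma_2, sq_nonneg kappa_2, sq_nonneg omega_1, sq_nonneg omega_2]) (by norm_num))
  have hB : ∀ i, |vars [sigma_1, kappa_1, sigma_2, kappa_2, omega_1, omega_2] i| ≤ ((vars deg4_A_recertD_deg4_A8eqb_lowh_boxB i : ℚ) : ℝ) := by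
    intro i
    match i with
    | 0 => simpa [deg4_A_recertD_deg4_A8eqb_lowh_boxB] using hb0
    | 1 => simpa [deg4_A_recertD_deg4_A8eqb_lowh_boxB] using hb1
    | 2 => simpa [deg4_A_recertD_deg4_A8eqb_lowh_boxB] using hb2
    | 3 => simpa [deg4_A_recertD_deg4_A8eqb_lowh_boxB] using hb3
    | 4 => simpa [deg4_A_recertD_deg4_A8eqb_lowh_boxB] using hb4
    | 5 => simpa [deg4_A_recertD_deg4_A8eqb_lowh_boxB] using hb5
    | n + 6 => simp [deg4_A_recertD_deg4_A8eqb_lowh_boxB, vars]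
  have h := PolyRecast.eval_le_absBox hB deg4_A_recertD_deg4_A8eqb_lowh_V_poly
  have hc : ((PolyRecast.absBox (vars deg4_A_recertD_deg4_A8eqb_lowh_boxB) deg4_A_recertD_deg4_A8eqb_lowh_V_poly : ℚ) : ℝ) ≤ ((49199 / 50000 : ℚ) : ℝ) :=
    Rat.cast_le.2 deg4_A_recertD_deg4_A8eqb_lowh_absBox_le
  have hc' : ((49199 / 50000 : ℚ) : ℝ) = 49199 / 50000 := by norm_num
  exact h.trans (hc.trans_eq hc')

end

end Summit.Ventures.GridStability.Bench.CHIANG3
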